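import Summits.QuantumFields.YangMills.Theorems.BalabanUVNodesN19RekeyingCalculus

/-!
# BalabanUVNodes ∕ node N19 (NE7) — THE RE-KEYING CALCULUS, H1L FACE: the route-of-record's output shape `Spine.NE7.PathLeaf` (a positive `C¹` path per good class whose
# log-derivative stays within `vol·δ_K` of ONE class-uniform drift) DESCENDS along every class map — paths ADD over a fibre, and the log-derivative of a sum of positive
# paths is a CONVEX COMBINATION of the summands' log-derivatives; it does NOT survive the bad ⇒ shell fold (a `PathLeaf` forces positive cores)

Cell `pub-ymgap` (HUMAN RULING D-0062 Track A ∕ D-0149 width seats), WIDTH SEAT `pub-ymgap-dag-n19-w1` (node n19 = NE7, seat 1 of 3), generation g2, INTENT-3; companion of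
this seat's `…N19RekeyingCalculus` (p593255: `Core` ∕ NE7b ∕ NE7c ∕ `HybridNE7` along a class map; the fold).  Route `Summits/QuantumFields/YangMills/Theses/BalabanUVNodes.lean`, key
item K3⁷ `SpineGivenEndpointR13SepCoPH` (stmt-QuantumFields-20544); filed `--kind proof --supports … --as helper`.  COUNT-NEUTRAL.  THEOREMS ONLY (0 `def`, 0 `sorry`).  ADDITIVE —
imports p593255 only (through it `Spine/NE7/Targets`: `PathLeaf`, `core_of_pathLeaf`; `T4MatchingAssembly.classVal`); Mathlib's `HasDerivWithinAt.fun_sum`; modifies nothing.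

WHY.  `Spine/NE7/Targets` §3 records the lens-1 route of record (H1L, `ROUTES-NE7.md` §L1.1) for N19's core clause as the shape `PathLeaf l₀ vol T Bad P Q δ` — per `K` ONE drift
`φ_K` with derivative `φ′_K` on `[0,1]`, and per good class a positive differentiable path `ρ_τ` from run A's core to run B's with `|ρ′_τ ∕ ρ_τ − φ′_K| ≤ vol·δ_K` — and the
calculus face `core_of_pathLeaf` (mean value inequality).  p593255 showed that `Core` descends along every class map of both runs (sandwiches with one class-uniform constant add
up).  This file shows the same ONE LEVEL UP, for the route's own output: over a coarse good class the fine paths `ρ_s` ADD to a positive path `Σ_s ρ_s` from `classVal P` to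
`classVal Q`, and `(Σ_s ρ_s)′ ∕ (Σ_s ρ_s) − φ′ = Σ_s (ρ_s ∕ Σ ρ)·(ρ′_s ∕ ρ_s − φ′)` is a convex combination, so the SAME drift `φ_K` and the SAME `δ` serve the coarse key — the
class-uniformity of the DRIFT is consumed exactly as the class-uniformity of the constant was in `core_classVal`.  So whichever key the H1L producers reach, every coarser key is
free, with `Core` following by `core_of_pathLeaf` at either end (`core_classVal_of_pathLeaf`: the two routes to the coarse `Core` agree).  Unlike `Core`, `PathLeaf` does NOT
survive the bad ⇒ shell fold of p593255 §5: a `PathLeaf` forces strictly positive cores on its good classes (`pos_of_pathLeaf`), while the fold's cores vanish on the formerly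
bad classes — after a fold one works at the `Core` level (`core_foldBad`), which tolerates zero cores.
* §1 [folklore] `abs_sum_div_sub_le` (the convex-combination bound: `ρ_s > 0`, `|ρ′_s ∕ ρ_s − d| ≤ η` for all `s` in a non-empty finite set ⇒ `|(Σ ρ′_s) ∕ (Σ ρ_s) − d| ≤ η`).
* §2 [folklore] ★★ `pathLeaf_classVal` (`PathLeaf` DESCENDS along a class map under the cover «fine bad ⇒ coarse bad» and NON-EMPTY good fibres; same drift, same `δ`) ·
  ★ `pathLeaf_image` (image key, bad := image: the only condition left is none — fibres over the image are non-empty) · `core_classVal_of_pathLeaf`.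
* §3 [folklore] `pos_of_pathLeaf` (a `PathLeaf` forces `0 < P`, `0 < Q` on every good class — why the fold is a `Core`-level operation).
* §4 (v1.1, append-only) [folklore] ★★ `pathLeaf_of_core` (THE CONVERSE OF THE H1L FACE: `Core` on positive cores ⇒ `PathLeaf`, by the
  log-linear interpolation `ρ(σ) = P·e^{σ(log Q − log P)}` with the linear drift `σ·c_K`) · ★ `pathLeaf_iff_core_of_pos` · `pathLeaf_iff_core_and_pos` — at the level of SHAPES the
  route-of-record output carries no information beyond `Core` + positivity; the route's content is in how Bałaban's interpolation PRODUCES the path.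

HONEST FRAMING.  Elementary real analysis over the tree's SHAPES [folklore]; producing `PathLeaf` for Bałaban's two runs is the H1L route's entire (unprinted) content and is NOT
touched; nothing of Bałaban's asserted or instantiated; NE7 NOT PRINTED for d = 4 ∕ NOT proved; N19 NOT discharged (0∕1); K3⁷ NOT claimed; counts UNMOVED (typed 28∕28 ·
discharged 5∕27).  Everything PROVED (0 `sorry`, standard axioms).  One finite four-torus programme at fixed ε — NOT ℝ⁴, NOT OS, NOT a mass gap, NOT the Clay problem (R4 closes
the conditional finite-𝕋⁴ rung `BalabanLadder.UV` only).
-/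

noncomputable section

namespace Summit.QuantumFields.YangMills.BalabanUVNodes.N19RekeyingCalculus

open Finset Set
open Summit.QuantumFields.BalabanUV.T4Continuum.Spine.NE7 (Core PathLeaf core_of_pathLeaf)
open Literature.MathematicalPhysics.QuantumFieldTheory.Balaban1983to89
open T4MatchingAssembly (classVal)

variable {σ ι : Type*} [DecidableEq ι]

/-! ## §1 The convex-combination bound -/

omit [DecidableEq ι] in
/-- **THE LOG-DERIVATIVE OF A SUM OF POSITIVE PATHS IS A CONVEX COMBINATION** [folklore]: if `0 < ρ_s` and `|ρ′_s ∕ ρ_s − d| ≤ η` for every `s` in a non-empty finite set, then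
`|(Σ_s ρ′_s) ∕ (Σ_s ρ_s) − d| ≤ η` — since `(Σ ρ′) − d·(Σ ρ) = Σ_s ρ_s·(ρ′_s ∕ ρ_s − d)` and `|Σ_s ρ_s·(…)| ≤ η·Σ_s ρ_s`. -/
theorem abs_sum_div_sub_le {Fb : Finset σ} {r r' : σ → ℝ} {d η : ℝ} (hne : Fb.Nonempty) (hpos : ∀ s ∈ Fb, 0 < r s)
    (hbd : ∀ s ∈ Fb, |r' s / r s - d| ≤ η) :
    |(∑ s ∈ Fb, r' s) / (∑ s ∈ Fb, r s) - d| ≤ η := by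
  have hR : 0 < ∑ s ∈ Fb, r s := Finset.sum_pos hpos hne
  have hterm : ∀ s ∈ Fb, |r' s - d * r s| ≤ η * r s := fun s hs => by
    have h1 : r' s - d * r s = r s * (r' s / r s - d) := by field_simp [(hpos s hs).ne']
    rw [h1, abs_mul, abs_of_pos (hpos s hs), mul_comm]
    exact mul_le_mul_of_nonneg_right (hbd s hs) (hpos s hs).le
  have hnum : |∑ s ∈ Fb, r' s - d * ∑ s ∈ Fb, r s| ≤ η * ∑ s ∈ Fb, r s := by
    rw [Finset.mul_sum, ← Finset.sum_sub_distrib, Finset.mul_sum]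
    exact (Finset.abs_sum_le_sum_abs _ _).trans (Finset.sum_le_sum hterm)
  have h2 : (∑ s ∈ Fb, r' s) / (∑ s ∈ Fb, r s) - d = (∑ s ∈ Fb, r' s - d * ∑ s ∈ Fb, r s) / ∑ s ∈ Fb, r s := by
    field_simp [hR.ne']
  rw [h2, abs_div, abs_of_pos hR, div_le_iff₀ hR]
  exact hnum

/-! ## §2 `PathLeaf` descends along every class map -/

section Descent
variable [DecidableEq σ] {l₀ vol : ℝ} {S : ℕ → Finset σ} {T : ℕ → Finset ι} {π : ℕ → σ → ι} {p q : ℕ → ℝ → σ → ℝ}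
  {SBad : ℕ → ℝ → Finset σ} {Bad : ℕ → ℝ → Finset ι} {δ : ℕ → ℝ}

/-- **★★ THE H1L OUTPUT `PathLeaf` DESCENDS ALONG A CLASS MAP** [folklore].  If the fine cores carry `PathLeaf l₀ vol S SBad p q δ`, the coarse bad class COVERS the fine one («fine bad ⇒
coarse bad») and every coarse GOOD class has a NON-EMPTY fibre, then the re-keyed cores carry `PathLeaf l₀ vol T Bad (classVal S π p) (classVal S π q) δ` with the SAME drift
`φ_K` and the SAME `δ`: the coarse path over `τ` is the SUM of the fine paths over its fibre (all fine-good by the cover) — from `classVal p` to `classVal q`, positive, differentiable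
within `[0,1]` (`HasDerivWithinAt.fun_sum`) — and its log-derivative is a convex combination of the fine ones (`abs_sum_div_sub_le`).  (Empty good fibres are excluded honestly: there
both re-keyed cores vanish and no positive path joins `0` to `0`; at the IMAGE key they do not occur, `pathLeaf_image`.) -/
theorem pathLeaf_classVal (h : PathLeaf l₀ vol S SBad p q δ)
    (hcover : ∀ (K : ℕ) (t : ℝ), |t| ≤ l₀ → ∀ s ∈ S K, s ∈ SBad K t → π K s ∈ Bad K t)
    (hne : ∀ (K : ℕ) (t : ℝ), |t| ≤ l₀ → ∀ τ ∈ T K \ Bad K t, ∃ s ∈ S K, π K s = τ) :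
    PathLeaf l₀ vol T Bad (classVal S π p) (classVal S π q) δ := by
  intro K
  obtain ⟨φ, φ', hφ, hK⟩ := h K
  refine ⟨φ, φ', hφ, fun t ht τ hτ => ?_⟩
  have hτ' : τ ∉ Bad K t := (Finset.mem_sdiff.mp hτ).2
  -- the fibre over `τ`, all of it fine-good
  have hgood : ∀ s ∈ (S K).filter (fun s => π K s = τ), s ∈ S K \ SBad K t := fun s hs => by
    obtain ⟨hsS, hπ⟩ := Finset.mem_filter.mp hs
    exact Finset.mem_sdiff.mpr ⟨hsS, fun hbad => hτ' (hπ ▸ hcover K t ht s hsS hbad)⟩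
  -- choose the fine paths (junk off the fibre)
  have hex : ∀ s : σ, ∃ ρ ρ' : ℝ → ℝ, s ∈ (S K).filter (fun s => π K s = τ) →
      ρ 0 = p K t s ∧ ρ 1 = q K t s ∧ (∀ x ∈ Icc (0 : ℝ) 1, 0 < ρ x ∧ HasDerivWithinAt ρ (ρ' x) (Icc (0 : ℝ) 1) x) ∧
        ∀ x ∈ Icc (0 : ℝ) 1, |ρ' x / ρ x - φ' x| ≤ vol * δ K := fun s => by
    by_cases hs : s ∈ (S K).filter (fun s => π K s = τ)
    · obtain ⟨ρ, ρ', h0, h1, hρ, hbd⟩ := hK t ht s (hgood s hs)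
      exact ⟨ρ, ρ', fun _ => ⟨h0, h1, hρ, hbd⟩⟩
    · exact ⟨fun _ => 0, fun _ => 0, fun h => absurd h hs⟩
  choose ρ ρ' hρ using hex
  have hFne : ((S K).filter (fun s => π K s = τ)).Nonempty := by
    obtain ⟨s, hs, hπ⟩ := hne K t ht τ hτ
    exact ⟨s, Finset.mem_filter.mpr ⟨hs, hπ⟩⟩
  refine ⟨fun x => ∑ s ∈ (S K).filter (fun s => π K s = τ), ρ s x, fun x => ∑ s ∈ (S K).filter (fun s => π K s = τ), ρ' s x, ?_, ?_, ?_, ?_⟩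
  · rw [classVal_apply]
    exact Finset.sum_congr rfl fun s hs => (hρ s hs).1
  · rw [classVal_apply]
    exact Finset.sum_congr rfl fun s hs => (hρ s hs).2.1
  · intro x hx
    exact ⟨Finset.sum_pos (fun s hs => ((hρ s hs).2.2.1 x hx).1) hFne,
      HasDerivWithinAt.fun_sum fun s hs => ((hρ s hs).2.2.1 x hx).2⟩
  · intro x hx
    exact abs_sum_div_sub_le hFne (fun s hs => ((hρ s hs).2.2.1 x hx).1) fun s hs => (hρ s hs).2.2.2 x hx

/-- **★ `PathLeaf` AT THE IMAGE KEY — NO SIDE CONDITION**: class set and bad class := the images (fibres over the image are non-empty, the cover is automatic). [folklore] -/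
theorem pathLeaf_image (h : PathLeaf l₀ vol S SBad p q δ) :
    PathLeaf l₀ vol (fun K => (S K).image (π K)) (fun K t => (SBad K t).image (π K)) (classVal S π p) (classVal S π q) δ :=
  pathLeaf_classVal h (fun K _ _ _ _ hs => Finset.mem_image_of_mem (π K) hs) fun K t _ τ hτ => by
    obtain ⟨s, hs, hπ⟩ := Finset.mem_image.mp (Finset.mem_sdiff.mp hτ).1
    exact ⟨s, hs, hπ⟩

/-- The two routes to the coarse `Core` agree: descend the `PathLeaf` and apply the calculus face `core_of_pathLeaf` at the coarse key (this lemma), or apply it at the fine key and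
descend the `Core` by p593255's `core_classVal` — either way the coarse key costs nothing. [folklore] -/
theorem core_classVal_of_pathLeaf (h : PathLeaf l₀ vol S SBad p q δ)
    (hcover : ∀ (K : ℕ) (t : ℝ), |t| ≤ l₀ → ∀ s ∈ S K, s ∈ SBad K t → π K s ∈ Bad K t)
    (hne : ∀ (K : ℕ) (t : ℝ), |t| ≤ l₀ → ∀ τ ∈ T K \ Bad K t, ∃ s ∈ S K, π K s = τ) :
    Core l₀ vol T Bad (classVal S π p) (classVal S π q) δ :=
  core_of_pathLeaf (pathLeaf_classVal h hcover hne)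

end Descent

/-! ## §3 Why the fold is a `Core`-level operation -/

/-- **A `PathLeaf` FORCES POSITIVE CORES** on every good class (the endpoints of a positive path) — so after p593255's bad ⇒ shell fold, whose cores VANISH on the formerly bad
classes, no `PathLeaf` can hold there unless the bad class was empty to begin with: the fold lives at the `Core` level (`core_foldBad`), which tolerates zero cores. [folklore] -/
theorem pos_of_pathLeaf {l₀ vol : ℝ} {T : ℕ → Finset ι} {Bad : ℕ → ℝ → Finset ι} {P Q : ℕ → ℝ → ι → ℝ} {δ : ℕ → ℝ}
    (h : PathLeaf l₀ vol T Bad P Q δ) (K : ℕ) {t : ℝ} (ht : |t| ≤ l₀) {τ : ι} (hτ : τ ∈ T K \ Bad K t) :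
    0 < P K t τ ∧ 0 < Q K t τ := by
  obtain ⟨φ, φ', -, hK⟩ := h K
  obtain ⟨ρ, ρ', h0, h1, hρ, -⟩ := hK t ht τ hτ
  exact ⟨h0 ▸ (hρ 0 (left_mem_Icc.mpr zero_le_one)).1, h1 ▸ (hρ 1 (right_mem_Icc.mpr zero_le_one)).1⟩

/-- SANITY (the convex-combination bound on explicit data): two unit paths with log-derivatives `0` and `1∕2`, drift `0`, tolerance `1∕2`. [folklore] -/
example : |(∑ s ∈ ({true, false} : Finset Bool), (fun b : Bool => if b then (0 : ℝ) else 1 / 2) s) /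
    (∑ s ∈ ({true, false} : Finset Bool), (fun _ : Bool => (1 : ℝ)) s) - 0| ≤ 1 / 2 :=
  abs_sum_div_sub_le (Fb := ({true, false} : Finset Bool)) (r := fun _ => (1 : ℝ)) (r' := fun b => if b then (0 : ℝ) else 1 / 2) (d := 0) (η := 1 / 2)
    ⟨true, by simp⟩ (fun _ _ => one_pos) fun s _ => by cases s <;> norm_num


/-! ## §4 (v1.1, append-only) The converse of the calculus face: `Core` on POSITIVE cores IS a `PathLeaf` (log-linear interpolation) -/

section Converse
variable {l₀ vol : ℝ} {T : ℕ → Finset ι} {Bad : ℕ → ℝ → Finset ι} {P Q : ℕ → ℝ → ι → ℝ} {δ : ℕ → ℝ}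

/-- **★★ THE CONVERSE OF THE H1L FACE: `Core` ON POSITIVE CORES IS A `PathLeaf`** [folklore].  Given `Core l₀ vol T Bad P Q δ` with `0 < P`, `0 < Q` on the good classes, the
LOG-LINEAR INTERPOLATION `ρ_τ(σ) := P·exp(σ·(log Q − log P))` is a positive `C¹` path from `P` to `Q` with CONSTANT log-derivative `log Q − log P`, and the linear drift
`φ_K(σ) := σ·c_K` has `φ′_K ≡ c_K`; the sandwich in logarithmic form is exactly `|ρ′∕ρ − φ′| ≤ vol·δ_K`.  So, at the level of SHAPES, the route-of-record output `PathLeaf` carries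
NO information beyond `Core` + positivity (`Spine/NE7/Targets.core_of_pathLeaf` is the other direction): the H1L route's content is in HOW Bałaban's interpolating densities
produce the path (its drift being the transported insertion), not in the existence of some path — a located reading for the planner, decided by nobody here. -/
theorem pathLeaf_of_core (h : Core l₀ vol T Bad P Q δ) (hP : ∀ (K : ℕ) (t : ℝ), |t| ≤ l₀ → ∀ τ ∈ T K \ Bad K t, 0 < P K t τ)
    (hQ : ∀ (K : ℕ) (t : ℝ), |t| ≤ l₀ → ∀ τ ∈ T K \ Bad K t, 0 < Q K t τ) : PathLeaf l₀ vol T Bad P Q δ := by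
  intro K
  obtain ⟨c, hc⟩ := h K
  refine ⟨fun σ => σ * c, fun _ => c, fun σ _ => (hasDerivAt_mul_const c).hasDerivWithinAt, fun t ht τ hτ => ?_⟩
  have hP0 := hP K t ht τ hτ
  have hQ0 := hQ K t ht τ hτ
  set L := Real.log (Q K t τ) - Real.log (P K t τ) with hL
  refine ⟨fun σ => P K t τ * Real.exp (σ * L), fun σ => P K t τ * (Real.exp (σ * L) * L), by simp, ?_, fun σ _ => ⟨mul_pos hP0 (Real.exp_pos _), ?_⟩, fun σ _ => ?_⟩
  · show P K t τ * Real.exp (1 * L) = Q K t τ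
    rw [one_mul, hL, Real.exp_sub, Real.exp_log hQ0, Real.exp_log hP0, mul_div_cancel₀ _ hP0.ne']
  · exact (((hasDerivAt_mul_const L).exp).const_mul (P K t τ)).hasDerivWithinAt
  · have hρ : P K t τ * Real.exp (σ * L) ≠ 0 := (mul_pos hP0 (Real.exp_pos _)).ne'
    have hquot : P K t τ * (Real.exp (σ * L) * L) / (P K t τ * Real.exp (σ * L)) = L := by
      field_simp
    rw [hquot, hL, abs_le]
    -- the sandwich in logarithmic form (cf. `…N19CoreMetric.abs_log_sub_log_sub_le_of_sandwich`, not imported to keep this file on p593255 only)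
    obtain ⟨hlo, hhi⟩ := hc t ht τ hτ
    have h1 := Real.log_le_log (mul_pos (Real.exp_pos _) hP0) hlo
    have h2 := Real.log_le_log hQ0 hhi
    rw [Real.log_mul (Real.exp_pos _).ne' hP0.ne', Real.log_exp] at h1 h2
    constructor <;> linarith

/-- **★ `PathLeaf` ⟺ `Core` ON POSITIVE CORES** [folklore]: the H1L output shape and the NE7-proper leaf agree wherever the cores are positive (`core_of_pathLeaf` ∕ `pathLeaf_of_core`;
positivity is forced by `PathLeaf` itself, `pos_of_pathLeaf`). -/
theorem pathLeaf_iff_core_of_pos (hP : ∀ (K : ℕ) (t : ℝ), |t| ≤ l₀ → ∀ τ ∈ T K \ Bad K t, 0 < P K t τ)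
    (hQ : ∀ (K : ℕ) (t : ℝ), |t| ≤ l₀ → ∀ τ ∈ T K \ Bad K t, 0 < Q K t τ) :
    PathLeaf l₀ vol T Bad P Q δ ↔ Core l₀ vol T Bad P Q δ :=
  ⟨core_of_pathLeaf, fun h => pathLeaf_of_core h hP hQ⟩

/-- `PathLeaf` ⟺ `Core` ∧ positive cores, with no side hypothesis. [folklore] -/
theorem pathLeaf_iff_core_and_pos :
    PathLeaf l₀ vol T Bad P Q δ ↔ Core l₀ vol T Bad P Q δ ∧
      (∀ (K : ℕ) (t : ℝ), |t| ≤ l₀ → ∀ τ ∈ T K \ Bad K t, 0 < P K t τ ∧ 0 < Q K t τ) :=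
  ⟨fun h => ⟨core_of_pathLeaf h, fun K _ ht _ hτ => pos_of_pathLeaf h K ht hτ⟩,
    fun h => pathLeaf_of_core h.1 (fun K t ht τ hτ => (h.2 K t ht τ hτ).1) fun K t ht τ hτ => (h.2 K t ht τ hτ).2⟩

end Converse

end Summit.QuantumFields.YangMills.BalabanUVNodes.N19RekeyingCalculus

end
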